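import Summits.BirchSwinnertonDyer.BirchSwinnertonDyer.Theorems.ThetaPartnerAtTwoSignedKatoUpToAtTwoLocalTowerPoints
import Summits.BirchSwinnertonDyer.Rank1Residual.Additive.KobayashiTowerGeneration
import HarnessLib

/-!
# Route `ThetaPartnerAtTwo` (TP2), crux K3 `SignedKatoDivisibilityUpToAtTwo` (item stmt-BirchSwinnertonDyer-20308),
# line `colemanrat` v3 — THE LOCAL THEORY AT `p = 2`, file 3: Kobayashi's generation step (Prop. 8.11 ⇒ 8.12 ii)) and
# the trace relations (Lemma 8.9) for tower points at EVERY prime (the tree's odd-`p` file `KobayashiTowerGeneration`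
# with `p ≠ 2` removed, stated for ANY family of tower points with the right logarithms)

HONEST FRAMING (cell `bsd-wall`, lead `bsd-wall-tp2-p2x` g2): THEOREMS ONLY — no definition, no named fact, no
instance, no `sorry`; pure local formal-group theory along `ℚ_p(μ_{p^∞})`; nothing about any Selmer group is
asserted; closes no item; BSD is NOT proved by any of this.

## Why this file

Second port of the tree's odd-`p` Kobayashi local series to every prime (see file 1,
`…SignedKatoUpToAtTwoLocalHonda`): in `KobayashiTowerPoints` / `KobayashiTowerGeneration` the hypothesis `p ≠ 2`
enters (a) through the Honda isomorphism (file 1) and (b) at ONE arithmetic spot, the Frobenius congruence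
`(ζ − 1)ᵖ ≡ ζᵖ − 1 (mod p)` in `𝒪_{ℚ_p(ζ_{p^m})}`, proved in the tree with `(−1)ᵖ = −1`; at `p = 2` the extra term
`(−1)² + 1 = 2 = p` is again `≡ 0 (mod p)` (`exists_frob_mem_layer_pred'` below). Everything else in those files
(`ell`, the trace identity `∑ σℓ_{m+1} = −p − ℓ_{m−1}`, the Galois behaviour of `Λ`) is already prime-free. To stay
definition-free the points are an ∃-FAMILY `c : ℕ → E(ℚ̄_p)` with `c_m ∈ L(m) ∩ E₁`, `Λ(c_m) = ℓ_m`
(`exists_towerPoints`: at every prime, from the Honda points of file 1 at `ζ_{p^m} − 1`; for odd `p` the tree's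
`cPt p M hp2 htr` is such a family), and the generation / trace theorems are stated for ANY such family.

## What is proved (`M/ℤ_p` with elliptic generic and special fibre, `a_p(M) = 0`, ANY prime `p`; `Ω = ℚ̄_p`,
## `L(m)` = points with coordinates in `layer p m = ℚ_p(ζ_{p^m})`, `E₁ = kernel`, `Λ = ptLogΩ`, `ℓ_m = ell p m`)

* (file 2, `…LocalTowerPoints`: the Frobenius congruence `exists_frob_mem_layer_pred'` / `frob_layerField'` and
  the family `exists_towerPoints` with `c_m ∈ L(m) ∩ E₁`, `Λ(c_m) = ℓ_m`, every prime.)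
* For ANY family `c` with these properties: `exists_closure_pt'` (closure correspondence `ℤ[Γ·ζ_m] → ℤ[Γ·c_m]`
  under `Λ` mod `layer (m−1)`), **`exists_sub_closure_sub_smul_mem'`** (Kobayashi's GENERATION STEP Prop. 8.11 ⇒
  8.12 ii): every `P ∈ L(m) ∩ E₁` is `≡` an integral combination of conjugates of `c_m` modulo `L(m−1) + p·E₁`),
  **`sum_act_add_mem'`** / **`sum_act_one_mem'`** (the TRACE RELATIONS of Lemma 8.9:
  `Tr_{m+1/m} c_{m+1} + c_{m−1} ∈ E(ℚ_p)`, `Tr_{1/0} c_1 ∈ E(ℚ_p)`), given no `p`-power torsion in the layer points.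
At `p = 2`, `a₂ = 0` these are Kobayashi §8.4 (Lemma 8.9, Prop. 8.11, Prop. 8.12 ii) generation half) along
`ℚ₂(ζ_{2^m})` — the μ_{2^∞}-tower inputs of the `2`-adic `±` Coleman theory (Kurihara–Otsuki 2006 p. 557,
asserted; Kitajima–Otsuki 2018 §3 shape with `k = ℚ₂`).

References: [Kobayashi2003] §8.4 (Lemma 8.9, Prop. 8.11, Prop. 8.12); [KuriharaOtsuki2006] p. 557, Prop. 1.4;
[KitajimaOtsuki2018] §3.1–3.2; [SerreLocalFields1979] Ch. IV §4.
-/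

set_option autoImplicit false
-- the Theorems namespace of this sub repeats the summit name by design (D-0017 nested layout)
set_option linter.dupNamespace false

noncomputable section

open scoped Classical Topology NNReal
open Filter PowerSeries Finset

namespace Summit.BirchSwinnertonDyer.BirchSwinnertonDyer.Theorems

namespace SignedKatoOffTwo.LocalAllPrimes

open Literature.RingTheory.FormalGroups WeierstrassCurve Field
open Summit.BirchSwinnertonDyer.Rank1Residual.Additive
open Summit.BirchSwinnertonDyer.Rank1Residual.Additive.PadicCyclotomicTower
open Summit.BirchSwinnertonDyer.Rank1Residual.Additive.HondaFss
open Summit.BirchSwinnertonDyer.Rank1Residual.Additive.BallEval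
open Literature.NumberTheory.GaloisRepresentations.LubinTate (unitBall mem_unitBall_iff)
open Literature.NumberTheory.EllipticCurves Literature.NumberTheory.EllipticCurves.FormalGroupChart

/-! ## §3 The closure correspondence, the generation step and the trace relations for ANY family of tower
points with the right logarithms, every prime -/

section Generation

variable (p : ℕ) [hp : Fact p.Prime] (M : WeierstrassCurve ℤ_[p])
  [hE : (M.map PadicInt.Coe.ringHom).IsElliptic] [hEt : (M.map PadicInt.toZMod).IsElliptic]

variable {p M}
variable [hintΩ : (genFibΩ p M).IsIntegral (Valued.v (R := PadicAlgCl p)).integer]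

omit hEt in
/-- **The closure correspondence** for a tower point `c_m ∈ L(m) ∩ E₁` with `Λ(c_m) = ℓ_m` (`m ≥ 1`): every
`z ∈ ℤ[Γ·ζ_m]` is `Λ(B)` modulo `layer (m−1)` for some `B ∈ ℤ[Γ·c_m] ⊆ L(m) ∩ E₁`. [cite: Kobayashi2003, Prop. 8.11] -/
theorem exists_closure_pt' (act : Field.absoluteGaloisGroup ℚ_[p] → (genFibΩ p M).toAffine.Point → (genFibΩ p M).toAffine.Point)
    (hact0 : ∀ σ, act σ 0 = 0)
    (hact : ∀ σ (x y : PadicAlgCl p) (h : (genFibΩ p M).toAffine.Nonsingular x y),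
      ∃ h', act σ (Affine.Point.some x y h) = Affine.Point.some (σ • x) (σ • y) h')
    {m : ℕ} (hm : 1 ≤ m) {cm : (genFibΩ p M).toAffine.Point}
    (hcL : cm ∈ subfieldPoints (genFibΩ p M) (layer p m).toSubfield coeffs_mem_layer)
    (hck : cm ∈ kernel (Valued.v (R := PadicAlgCl p)) (genFibΩ p M)) (hcℓ : ptLogΩ p M cm = ell p m)
    {z : PadicAlgCl p}
    (hz : z ∈ AddSubgroup.closure (Set.range fun σ : Field.absoluteGaloisGroup ℚ_[p] => σ • zeta p m)) :
    ∃ B ∈ AddSubgroup.closure (Set.range fun σ : Field.absoluteGaloisGroup ℚ_[p] => act σ cm),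
      B ∈ subfieldPoints (genFibΩ p M) (layer p m).toSubfield coeffs_mem_layer ∧
      B ∈ kernel (Valued.v (R := PadicAlgCl p)) (genFibΩ p M) ∧ ptLogΩ p M B - z ∈ layer p (m - 1) := by
  haveI := isIntegral_curveK p (LayerField p m) M
  have hcz : ‖cm.zCoord‖ < 1 := by
    have := val_zCoord_lt_one hck
    rwa [PadicAlgCl.valuation_def, ← NNReal.coe_lt_coe, coe_nnnorm, NNReal.coe_one] at this
  induction hz using AddSubgroup.closure_induction with
  | mem x hx =>
    obtain ⟨σ, rfl⟩ := hx
    refine ⟨act σ cm, AddSubgroup.subset_closure ⟨σ, rfl⟩,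
      act_mem_subfieldPoints act hact0 hact σ hcL, act_mem_kernel act hact0 hact σ hck, ?_⟩
    rw [ptLogΩ_act act hact0 hact σ hcz, hcℓ]
    have e : σ • ell p m - σ • zeta p m = σ • (ell p m - (zeta p m - 1)) - 1 := by
      rw [smul_sub, smul_sub, smul_one]; ring
    change σ • ell p m - σ • zeta p m ∈ layer p (m - 1)
    rw [e]
    exact IntermediateField.sub_mem _ (smul_mem_layer σ (ell_sub_mem_layer_pred hm)) (IntermediateField.one_mem _)
  | zero =>
    refine ⟨0, AddSubgroup.zero_mem _, (subfieldPoints _ _ _).zero_mem,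
      (kernel (Valued.v (R := PadicAlgCl p)) (genFibΩ p M)).zero_mem, ?_⟩
    rw [ptLogΩ_zero, sub_zero]; exact IntermediateField.zero_mem _
  | add x y _ _ ihx ihy =>
    obtain ⟨B₁, hB₁, hB₁L, hB₁k, h₁⟩ := ihx
    obtain ⟨B₂, hB₂, hB₂L, hB₂k, h₂⟩ := ihy
    refine ⟨B₁ + B₂, AddSubgroup.add_mem _ hB₁ hB₂, (subfieldPoints _ _ _).add_mem hB₁L hB₂L,
      (kernel (Valued.v (R := PadicAlgCl p)) (genFibΩ p M)).add_mem hB₁k hB₂k, ?_⟩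
    rw [ptLogΩ_add (m := m) hB₁L hB₂L hB₁k hB₂k]
    have e : ptLogΩ p M B₁ + ptLogΩ p M B₂ - (x + y) = (ptLogΩ p M B₁ - x) + (ptLogΩ p M B₂ - y) := by ring
    rw [e]; exact IntermediateField.add_mem _ h₁ h₂
  | neg x _ ih =>
    obtain ⟨B, hB, hBL, hBk, h⟩ := ih
    refine ⟨-B, AddSubgroup.neg_mem _ hB, (subfieldPoints _ _ _).neg_mem hBL,
      (kernel (Valued.v (R := PadicAlgCl p)) (genFibΩ p M)).neg_mem hBk, ?_⟩
    have hneg : ptLogΩ p M (-B) = -ptLogΩ p M B := by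
      have h0 := ptLogΩ_sub (m := m) (subfieldPoints _ _ _).zero_mem hBL
        (kernel (Valued.v (R := PadicAlgCl p)) (genFibΩ p M)).zero_mem hBk
      rw [zero_sub, ptLogΩ_zero, zero_sub] at h0
      exact h0
    rw [hneg]
    have e : -ptLogΩ p M B - -x = -(ptLogΩ p M B - x) := by ring
    rw [e]; exact IntermediateField.neg_mem _ h

/-- **Kobayashi's generation step at EVERY prime** ([K] Prop. 8.11 ⇒ Prop. 8.12 ii)): for `m ≥ 1`, a good
supersingular `a_p = 0` model, a tower point `c_m ∈ L(m) ∩ E₁` with `Λ(c_m) = ℓ_m`, and `P ∈ L(m) ∩ E₁` (a point of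
`E₁(ℚ_p(ζ_{p^m}))`), there are `B ∈ ℤ[Γ·c_m]` and `R ∈ L(m) ∩ E₁` with `P − B − p•R ∈ L(m−1)` — provided `L(m)` has no
`p`-power torsion. Proof = the tree's odd-`p` proof with the all-primes Honda points (file 1) and the all-primes
Frobenius congruence (§1); the bound `‖p²‖ ≤ 1/4` used for the surjectivity of `Λ` onto `p³𝒪` holds at `p = 2` with
equality. [cite: Kobayashi2003, Prop. 8.11, Prop. 8.12] -/
theorem exists_sub_closure_sub_smul_mem'
    (htr : Literature.NumberTheory.EllipticCurves.HasseManin.tr (M.map PadicInt.toZMod) = 0)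
    (act : Field.absoluteGaloisGroup ℚ_[p] → (genFibΩ p M).toAffine.Point → (genFibΩ p M).toAffine.Point)
    (hact0 : ∀ σ, act σ 0 = 0)
    (hact : ∀ σ (x y : PadicAlgCl p) (h : (genFibΩ p M).toAffine.Nonsingular x y),
      ∃ h', act σ (Affine.Point.some x y h) = Affine.Point.some (σ • x) (σ • y) h')
    {m : ℕ} (hm : 1 ≤ m) {cm : (genFibΩ p M).toAffine.Point}
    (hcL : cm ∈ subfieldPoints (genFibΩ p M) (layer p m).toSubfield coeffs_mem_layer)
    (hck : cm ∈ kernel (Valued.v (R := PadicAlgCl p)) (genFibΩ p M)) (hcℓ : ptLogΩ p M cm = ell p m)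
    (htors : ∀ Q ∈ subfieldPoints (genFibΩ p M) (layer p m).toSubfield coeffs_mem_layer, ∀ k : ℕ, p ^ k • Q = 0 → Q = 0)
    {P : (genFibΩ p M).toAffine.Point} (hP : P ∈ subfieldPoints (genFibΩ p M) (layer p m).toSubfield coeffs_mem_layer)
    (hPk : P ∈ kernel (Valued.v (R := PadicAlgCl p)) (genFibΩ p M)) :
    ∃ B ∈ AddSubgroup.closure (Set.range fun σ : Field.absoluteGaloisGroup ℚ_[p] => act σ cm),
      ∃ R ∈ subfieldPoints (genFibΩ p M) (layer p m).toSubfield coeffs_mem_layer,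
        R ∈ kernel (Valued.v (R := PadicAlgCl p)) (genFibΩ p M) ∧
        P - B - p • R ∈ subfieldPoints (genFibΩ p M) (layer p (m - 1)).toSubfield coeffs_mem_layer := by
  haveI := isIntegral_curveK p (LayerField p m) M
  -- lift `P` to `K = K_m`
  obtain ⟨PK, rfl⟩ := exists_toOmega_eq hP
  have hPKk : PK ∈ kernel (NormedField.valuation (K := LayerField p m)) (curveK p (LayerField p m) M) :=
    (toOmega_mem_kernel_iff PK).mp hPk
  -- (BR1): `Λ(P) = μ₀ + y`, `μ₀ ∈ K_{m−1}`, `‖y‖ ≤ 1`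
  set K' : Subfield (LayerField p m) := Subfield.comap (LayerField.emb p m).toRingHom (layer p (m - 1)).toSubfield with hK'
  obtain ⟨μ₀, hμ₀, hμ₀y⟩ := exists_mem_norm_ptLog_sub_le_one' htr K' (frob_layerField' p hm) hPKk
  set y : LayerField p m := ptLog p (LayerField p m) M PK - μ₀ with hy
  have hμ₀L : LayerField.emb p m μ₀ ∈ layer p (m - 1) := hμ₀
  -- (DEC): `emb y − p³ y'Ω ∈ ℤ[Γ·ζ_m] + layer (m−1)`
  obtain ⟨y'Ω, hy'L, hy'1, hdec⟩ := exists_sub_pow_mul_mem_closure_sup p hm (LayerField.emb_mem y)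
    (by rw [LayerField.norm_emb]; exact hμ₀y) 3
  obtain ⟨z, hz, ν, hν, hzν⟩ := AddSubgroup.mem_sup.mp hdec
  have hνL : ν ∈ layer p (m - 1) := hν
  -- local surjectivity: `p³ y' = Λ(p • RK)`
  set y'K : LayerField p m := LayerField.mk p m y'Ω hy'L with hy'K
  have hp1 : ‖(p : LayerField p m)‖ = (p : ℝ)⁻¹ := by
    rw [← LayerField.norm_emb, map_natCast, ← map_natCast (algebraMap ℚ_[p] (PadicAlgCl p)) p]
    exact (PadicAlgCl.norm_extends (p := p) (p : ℚ_[p])).trans Padic.norm_p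
  have htarget : ‖(p : LayerField p m) ^ 2 * y'K‖ ≤ 1 / 4 := by
    rw [norm_mul, norm_pow, hp1]
    have hy'n : ‖y'K‖ ≤ 1 := by rw [hy'K, ← LayerField.norm_emb, LayerField.emb_mk]; exact hy'1
    have hp2' : (2 : ℝ) ≤ p := by exact_mod_cast hp.out.two_le
    have hinv : (p : ℝ)⁻¹ ≤ 1 / 2 := by rw [one_div]; exact inv_anti₀ two_pos hp2'
    calc (p : ℝ)⁻¹ ^ 2 * ‖y'K‖ ≤ (1 / 2) ^ 2 * 1 :=
          mul_le_mul (pow_le_pow_left₀ (by positivity) hinv 2) hy'n (norm_nonneg _) (by positivity)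
      _ = 1 / 4 := by norm_num
  obtain ⟨RK, hRKk, hΛR, -⟩ := exists_ptLog_eq (p := p) (M := M) htarget
  have hΛpR : ptLog p (LayerField p m) M (p • RK) = (p : LayerField p m) ^ 3 * y'K := by
    rw [ptLog_nsmul hRKk, hΛR]; ring
  -- the `Γ`-combination of conjugates of `c_m`
  obtain ⟨B, hB, hBL, hBk, hBz⟩ := exists_closure_pt' act hact0 hact hm hcL hck hcℓ hz
  set νB := ptLogΩ p M B - z with hνB
  -- assemble
  refine ⟨B, hB, toOmega p M m RK, toOmega_mem_subfieldPoints _, (toOmega_mem_kernel_iff RK).mpr hRKk, ?_⟩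
  have hPRL : toOmega p M m PK - B - p • toOmega p M m RK ∈ subfieldPoints (genFibΩ p M) (layer p m).toSubfield coeffs_mem_layer :=
    (subfieldPoints _ _ _).sub_mem ((subfieldPoints _ _ _).sub_mem (toOmega_mem_subfieldPoints _) hBL)
      ((subfieldPoints _ _ _).nsmul_mem (toOmega_mem_subfieldPoints _) _)
  have hpRk : p • toOmega p M m RK ∈ kernel (Valued.v (R := PadicAlgCl p)) (genFibΩ p M) :=
    (kernel (Valued.v (R := PadicAlgCl p)) (genFibΩ p M)).nsmul_mem ((toOmega_mem_kernel_iff RK).mpr hRKk) _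
  have hPRk : toOmega p M m PK - B - p • toOmega p M m RK ∈ kernel (Valued.v (R := PadicAlgCl p)) (genFibΩ p M) :=
    (kernel (Valued.v (R := PadicAlgCl p)) (genFibΩ p M)).sub_mem ((kernel (Valued.v (R := PadicAlgCl p)) (genFibΩ p M)).sub_mem hPk hBk) hpRk
  refine mem_subfieldPoints_of_ptLogΩ_mem act hact0 hact htors hPRL hPRk ?_
  -- the logarithm of `P − B − p•R`
  have hΛP : ptLogΩ p M (toOmega p M m PK) = LayerField.emb p m μ₀ + LayerField.emb p m y := by
    rw [ptLogΩ_toOmega hPKk, hy, ← map_add]; congr 1; ring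
  have hΛpR' : ptLogΩ p M (p • toOmega p M m RK) = (p : PadicAlgCl p) ^ 3 * y'Ω := by
    rw [← map_nsmul, ptLogΩ_toOmega ((kernel (NormedField.valuation (K := LayerField p m))
      (curveK p (LayerField p m) M)).nsmul_mem hRKk _), hΛpR, map_mul, map_pow, map_natCast, hy'K, LayerField.emb_mk]
  rw [ptLogΩ_sub (m := m) ((subfieldPoints _ _ _).sub_mem (toOmega_mem_subfieldPoints _) hBL)
      ((subfieldPoints _ _ _).nsmul_mem (toOmega_mem_subfieldPoints _) _)
      ((kernel (Valued.v (R := PadicAlgCl p)) (genFibΩ p M)).sub_mem hPk hBk) hpRk,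
    ptLogΩ_sub (m := m) (toOmega_mem_subfieldPoints _) hBL hPk hBk, hΛP, hΛpR']
  have eB : ptLogΩ p M B = z + νB := by rw [hνB]; ring
  rw [eB]
  have e : LayerField.emb p m μ₀ + LayerField.emb p m y - (z + νB) - (p : PadicAlgCl p) ^ 3 * y'Ω =
      LayerField.emb p m μ₀ + ν - νB + (LayerField.emb p m y - (p : PadicAlgCl p) ^ 3 * y'Ω - (z + ν)) := by ring
  rw [e, hzν, sub_self, add_zero]
  exact IntermediateField.sub_mem _ (IntermediateField.add_mem _ hμ₀L hνL) hBz

omit hEt in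
/-- **The trace relation of [K] Lemma 8.9 at EVERY prime, `m ≥ 1`**: for tower points `c_{m+1} ∈ L(m+1) ∩ E₁`,
`c_{m−1} ∈ L(m−1) ∩ E₁` with `Λ = ℓ`, `(∑_{q ∈ stab m / stab (m+1)} act q̃ c_{m+1}) + c_{m−1}` has logarithm `−p`
(trace identity `∑σℓ_{m+1} = −p − ℓ_{m−1}`, valid at `p = 2`: `Tr_{ℚ₂(ζ_{2^{m+1}})/ℚ₂(ζ_{2^m})}(ζ_{2^{m+1}} − 1) = −2`), hence
lies in `L(0) = E(ℚ_p)` (given no `p`-power torsion in `L(m+1)`). [cite: Kobayashi2003, Lemma 8.9] -/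
theorem sum_act_add_mem' (act : Field.absoluteGaloisGroup ℚ_[p] → (genFibΩ p M).toAffine.Point → (genFibΩ p M).toAffine.Point)
    (hact0 : ∀ σ, act σ 0 = 0)
    (hact : ∀ σ (x y : PadicAlgCl p) (h : (genFibΩ p M).toAffine.Nonsingular x y),
      ∃ h', act σ (Affine.Point.some x y h) = Affine.Point.some (σ • x) (σ • y) h')
    {m : ℕ} (hm : 1 ≤ m)
    [Fintype (stab p m ⧸ (stab p (m + 1)).subgroupOf (stab p m))]
    (htors : ∀ Q ∈ subfieldPoints (genFibΩ p M) (layer p (m + 1)).toSubfield coeffs_mem_layer, ∀ k : ℕ, p ^ k • Q = 0 → Q = 0)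
    {c c' : (genFibΩ p M).toAffine.Point}
    (hcL : c ∈ subfieldPoints (genFibΩ p M) (layer p (m + 1)).toSubfield coeffs_mem_layer)
    (hck : c ∈ kernel (Valued.v (R := PadicAlgCl p)) (genFibΩ p M)) (hcℓ : ptLogΩ p M c = ell p (m + 1))
    (hc'L : c' ∈ subfieldPoints (genFibΩ p M) (layer p (m - 1)).toSubfield coeffs_mem_layer)
    (hc'k : c' ∈ kernel (Valued.v (R := PadicAlgCl p)) (genFibΩ p M)) (hc'ℓ : ptLogΩ p M c' = ell p (m - 1)) :
    (∑ q : stab p m ⧸ (stab p (m + 1)).subgroupOf (stab p m), act ((q.out : stab p m) : Field.absoluteGaloisGroup ℚ_[p]) c) +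
        c' ∈ subfieldPoints (genFibΩ p M) (layer p 0).toSubfield coeffs_mem_layer := by
  haveI := isIntegral_curveK p (LayerField p (m + 1)) M
  have hcz : ‖c.zCoord‖ < 1 := by
    have := val_zCoord_lt_one hck
    rwa [PadicAlgCl.valuation_def, ← NNReal.coe_lt_coe, coe_nnnorm, NNReal.coe_one] at this
  have hSL : (∑ q : stab p m ⧸ (stab p (m + 1)).subgroupOf (stab p m), act ((q.out : stab p m) : Field.absoluteGaloisGroup ℚ_[p]) c) ∈
      subfieldPoints (genFibΩ p M) (layer p (m + 1)).toSubfield coeffs_mem_layer :=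
    (subfieldPoints _ _ _).sum_mem fun q _ => act_mem_subfieldPoints act hact0 hact _ hcL
  have hSk : (∑ q : stab p m ⧸ (stab p (m + 1)).subgroupOf (stab p m), act ((q.out : stab p m) : Field.absoluteGaloisGroup ℚ_[p]) c) ∈
      kernel (Valued.v (R := PadicAlgCl p)) (genFibΩ p M) :=
    (kernel (Valued.v (R := PadicAlgCl p)) (genFibΩ p M)).sum_mem fun q _ => act_mem_kernel act hact0 hact _ hck
  have hc'L' : c' ∈ subfieldPoints (genFibΩ p M) (layer p (m + 1)).toSubfield coeffs_mem_layer :=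
    subfieldPoints_layer_mono (by omega) hc'L
  refine mem_subfieldPoints_of_ptLogΩ_mem act hact0 hact htors
    ((subfieldPoints _ _ _).add_mem hSL hc'L') ((kernel (Valued.v (R := PadicAlgCl p)) (genFibΩ p M)).add_mem hSk hc'k) ?_
  rw [ptLogΩ_add (m := m + 1) hSL hc'L' hSk hc'k,
    ptLogΩ_finset_sum (m := m + 1) _ _ (fun q _ => act_mem_subfieldPoints act hact0 hact _ hcL)
      (fun q _ => act_mem_kernel act hact0 hact _ hck)]
  simp_rw [ptLogΩ_act act hact0 hact _ hcz, hcℓ, hc'ℓ]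
  rw [sum_smul_ell_succ hm]
  have e : -(p : PadicAlgCl p) - ell p (m - 1) + ell p (m - 1) = -(p : PadicAlgCl p) := by ring
  rw [e]
  exact IntermediateField.neg_mem _ (by exact_mod_cast IntermediateField.natCast_mem (layer p 0) p)

omit hEt in
/-- **The trace relation at the bottom, EVERY prime**: `∑_{q ∈ Γ / stab 1} act q̃ c_1 ∈ L(0) = E(ℚ_p)` for a tower point
`c_1` with `Λ(c_1) = ℓ_1 = ζ_p − 1` (its trace is `−p`; at `p = 2`: `ζ_2 − 1 = −2` and `Γ = stab 1`), given no
`p`-power torsion in `L(1)`. [cite: Kobayashi2003, Lemma 8.9] -/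
theorem sum_act_one_mem' (act : Field.absoluteGaloisGroup ℚ_[p] → (genFibΩ p M).toAffine.Point → (genFibΩ p M).toAffine.Point)
    (hact0 : ∀ σ, act σ 0 = 0)
    (hact : ∀ σ (x y : PadicAlgCl p) (h : (genFibΩ p M).toAffine.Nonsingular x y),
      ∃ h', act σ (Affine.Point.some x y h) = Affine.Point.some (σ • x) (σ • y) h')
    [Fintype (stab p 0 ⧸ (stab p 1).subgroupOf (stab p 0))]
    (htors : ∀ Q ∈ subfieldPoints (genFibΩ p M) (layer p 1).toSubfield coeffs_mem_layer, ∀ k : ℕ, p ^ k • Q = 0 → Q = 0)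
    {c : (genFibΩ p M).toAffine.Point}
    (hcL : c ∈ subfieldPoints (genFibΩ p M) (layer p 1).toSubfield coeffs_mem_layer)
    (hck : c ∈ kernel (Valued.v (R := PadicAlgCl p)) (genFibΩ p M)) (hcℓ : ptLogΩ p M c = ell p 1) :
    (∑ q : stab p 0 ⧸ (stab p 1).subgroupOf (stab p 0), act ((q.out : stab p 0) : Field.absoluteGaloisGroup ℚ_[p]) c) ∈
      subfieldPoints (genFibΩ p M) (layer p 0).toSubfield coeffs_mem_layer := by
  haveI := isIntegral_curveK p (LayerField p 1) M
  have hcz : ‖c.zCoord‖ < 1 := by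
    have := val_zCoord_lt_one hck
    rwa [PadicAlgCl.valuation_def, ← NNReal.coe_lt_coe, coe_nnnorm, NNReal.coe_one] at this
  have hSL : (∑ q : stab p 0 ⧸ (stab p 1).subgroupOf (stab p 0), act ((q.out : stab p 0) : Field.absoluteGaloisGroup ℚ_[p]) c) ∈
      subfieldPoints (genFibΩ p M) (layer p 1).toSubfield coeffs_mem_layer :=
    (subfieldPoints _ _ _).sum_mem fun q _ => act_mem_subfieldPoints act hact0 hact _ hcL
  have hSk : (∑ q : stab p 0 ⧸ (stab p 1).subgroupOf (stab p 0), act ((q.out : stab p 0) : Field.absoluteGaloisGroup ℚ_[p]) c) ∈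
      kernel (Valued.v (R := PadicAlgCl p)) (genFibΩ p M) :=
    (kernel (Valued.v (R := PadicAlgCl p)) (genFibΩ p M)).sum_mem fun q _ => act_mem_kernel act hact0 hact _ hck
  refine mem_subfieldPoints_of_ptLogΩ_mem act hact0 hact htors hSL hSk ?_
  rw [ptLogΩ_finset_sum (m := 1) _ _ (fun q _ => act_mem_subfieldPoints act hact0 hact _ hcL)
      (fun q _ => act_mem_kernel act hact0 hact _ hck)]
  simp_rw [ptLogΩ_act act hact0 hact _ hcz, hcℓ]
  rw [sum_smul_ell_one]
  exact IntermediateField.neg_mem _ (by exact_mod_cast IntermediateField.natCast_mem (layer p 0) p)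

end Generation

end SignedKatoOffTwo.LocalAllPrimes

end Summit.BirchSwinnertonDyer.BirchSwinnertonDyer.Theorems

end
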